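import Summits.NavierStokesRegularity.FunctionalMining.StrainL4Pointwise
import Summits.NavierStokesRegularity.FunctionalMining.StrainFlat
import Summits.NavierStokesRegularity.FunctionalMining.StrainCZ
import Summits.NavierStokesRegularity.FunctionalMining.VorticityL4SaturatingLaw
import Literature.Analysis.FluidPDE.TorusNSPressureGradientBudget
import HarnessLib

/-!
# FunctionalMining — static production and pressure bounds for `∫|S|⁴` on `T³`
# (row `ES.absS.q=4|T_LD|G1`)

Search for candidate a priori estimates; no regularity claim. Cell `pub-nsfunc`, prove seat
(gen 9). With `Q = |S|²`, `B_n = ∫ Q^{n/2}` (`B₂ = ℰ`, `B₄ = ∫|S|⁴`), `I = ∫ Q ∑ₖ∑ᵢⱼ(∂ₖSᵢⱼ)²`,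
`g = ∑ₖ‖∂ₖu‖²`: the two source terms of the `∫|S|⁴` balance (`StrainWeightedBalance` with
`Ψ(s) = s²`), the nonlinear one `X_N = ∫ Q ∑ᵢⱼSᵢⱼ∑ₖ(∂ᵢu)ₖ(∂ₖu)ⱼ` and the pressure one
`X_P = ∫ Q ∑ᵢⱼSᵢⱼ∂ᵢ∂ⱼp`, satisfy `|X|¹⁴ ≤ K' B₄⁶ B₂⁵ I⁹` — the same exponent pattern as the
vorticity row `E.q=4` (`VorticityL4.production_pow_fourteen_le`), from the Cauchy–Schwarz steps of
`StrainL4Pointwise`, Calderón–Zygmund twice (`‖∇u‖₈ ≲ ‖S‖₈`, `StrainCZ`; `‖∇²p‖₄ ≲ ‖|∇u|²‖₄`,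
`Torus.exists_pressureHessian_Ls_le_gradSq`) and the codomain-generic top node
`∫|S|¹² ≤ C_T I³` (`StrainFlat.exists_strainSq_pow_six_le_cube`).

## Main statements

* `exists_integral_gradSq_pow_four_le_strain` — `∫g⁴ ≤ K ∫Q⁴` (CZ, `s = 8`).
* `exists_integral_hess_pow_four_le` — `∫|∂ᵢ∂ⱼp|⁴ ≤ C ∫g⁴` along unforced solutions (CZ, `q = 4`).
* `nonlinear_production_bound`, `pressure_production_bound` — `|X|¹⁴ ≤ K' B₄⁶ B₂⁵ I⁹`.
-/

noncomputable section

open MeasureTheory Finset Set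
open scoped InnerProductSpace RealInnerProductSpace ContDiff

namespace Summit.NavierStokesRegularity.FunctionalMining

open Literature.Analysis.FunctionSpaces Literature.Analysis.FunctionSpaces.Torus
  Literature.Analysis.FluidPDE

namespace StrainL4

/-! ## 1. Calderón–Zygmund in natural powers -/

/-- **`∫(∑ₖ‖∂ₖv‖²)⁴ ≤ K ∫|S|⁸`** for smooth divergence-free `v` on `T³` (the strain
Calderón–Zygmund estimate `StrainTensor.exists_gradLs_le_strainLs` at `s = 8`, eighth power).
[cite: MajdaBertozziCUP2002, §11.1 with Prop. 10.6] -/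
theorem exists_integral_gradSq_pow_four_le_strain :
    ∃ K : ℝ, 0 ≤ K ∧ ∀ v : UnitAddTorus (Fin 3) → EuclideanSpace ℝ (Fin 3), IsSmooth v →
      IsDivFree v →
      ∫ x, (∑ k, ‖partialDeriv k v x‖ ^ 2) ^ 4 ≤ K * ∫ x, torusStrainSqAt v x ^ 4 := by
  obtain ⟨K, hK0, hK⟩ := StrainTensor.exists_gradLs_le_strainLs (s := 8) (by norm_num)
  refine ⟨K ^ 8, by positivity, fun v hv hdiv => ?_⟩
  have h := hK v hv hdiv
  have e1 : ∫ x, Real.sqrt (∑ j, ‖partialDeriv j v x‖ ^ 2) ^ (8 : ℝ) =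
      ∫ x, (∑ k, ‖partialDeriv k v x‖ ^ 2) ^ 4 :=
    integral_congr_ae (ae_of_all _ fun x => by
      show Real.sqrt (∑ j, ‖partialDeriv j v x‖ ^ 2) ^ (8 : ℝ) = (∑ k, ‖partialDeriv k v x‖ ^ 2) ^ 4
      exact VorticityL4.sqrt_rpow_eight (Finset.sum_nonneg fun k _ => sq_nonneg _))
  have e2 : ∫ x, Real.sqrt (torusStrainSqAt v x) ^ (8 : ℝ) = ∫ x, torusStrainSqAt v x ^ 4 :=
    integral_congr_ae (ae_of_all _ fun x => by
      show Real.sqrt (torusStrainSqAt v x) ^ (8 : ℝ) = torusStrainSqAt v x ^ 4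
      exact VorticityL4.sqrt_rpow_eight (torusStrainSqAt_nonneg v x))
  rw [e1, e2] at h
  exact VorticityL4.le_of_rpow_inv_eight_le (integral_nonneg fun x => by positivity)
    (integral_nonneg fun x => pow_nonneg (torusStrainSqAt_nonneg v x) 4) h

/-- From `a^{1/4} ≤ C b^{1/4}` with `a, b ≥ 0` to `a ≤ C⁴ b`. [folklore] -/
theorem le_of_rpow_inv_four_le {a b C : ℝ} (ha : 0 ≤ a) (hb : 0 ≤ b)
    (h : a ^ (1 / (4 : ℝ)) ≤ C * b ^ (1 / (4 : ℝ))) : a ≤ C ^ 4 * b := by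
  have h4 := pow_le_pow_left₀ (Real.rpow_nonneg ha _) h 4
  have ea : (a ^ (1 / (4 : ℝ))) ^ 4 = a := by
    rw [← Real.rpow_natCast, ← Real.rpow_mul ha]; norm_num
  have eb : (b ^ (1 / (4 : ℝ))) ^ 4 = b := by
    rw [← Real.rpow_natCast, ← Real.rpow_mul hb]; norm_num
  rw [ea, mul_pow, eb] at h4
  exact h4

/-- **`∫|∂ᵢ∂ⱼp|⁴ ≤ C ∫(∑ₖ‖∂ₖu‖²)⁴`** along every classical solution of unforced Navier–Stokes on
`T^d` (the pressure-Hessian Calderón–Zygmund bound `Torus.exists_pressureHessian_Ls_le_gradSq` at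
`q = 4`, fourth power). [cite: RobinsonRodrigoSadowski2016, Thm B.7 and Ch. 5 (5.3)] -/
theorem exists_integral_hess_pow_four_le {d : Type*} [Fintype d] [DecidableEq d] :
    ∃ C : ℝ, 0 ≤ C ∧ ∀ {a b ν : ℝ}, a < b →
      ∀ {u : ℝ → UnitAddTorus d → EuclideanSpace ℝ d} {p : ℝ → UnitAddTorus d → ℝ},
        Torus.IsClassicalNSSolutionOn (Icc a b) ν 0 u p → ∀ t ∈ Icc a b, ∀ i j : d,
          ∫ x, |Torus.partialDeriv i (Torus.partialDeriv j (p t)) x| ^ 4 ≤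
            C * ∫ x, (∑ k, ‖Torus.partialDeriv k (u t) x‖ ^ 2) ^ 4 := by
  obtain ⟨C, hC0, hC⟩ := Torus.exists_pressureHessian_Ls_le_gradSq (d := d) (q := 4) (by norm_num)
  refine ⟨C ^ 4, by positivity, fun {a b ν} hab {u p} hsol t ht i j => ?_⟩
  have h := hC hab hsol t ht i j
  have e4 : (4 : ℝ) = ((4 : ℕ) : ℝ) := by norm_num
  have e1 : ∫ x, |Torus.partialDeriv i (Torus.partialDeriv j (p t)) x| ^ (4 : ℝ) =
      ∫ x, |Torus.partialDeriv i (Torus.partialDeriv j (p t)) x| ^ 4 :=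
    integral_congr_ae (ae_of_all _ fun x => by
      show |Torus.partialDeriv i (Torus.partialDeriv j (p t)) x| ^ (4 : ℝ) = _
      rw [e4, Real.rpow_natCast])
  have e2 : ∫ x, (∑ k, ‖Torus.partialDeriv k (u t) x‖ ^ 2) ^ (4 : ℝ) =
      ∫ x, (∑ k, ‖Torus.partialDeriv k (u t) x‖ ^ 2) ^ 4 :=
    integral_congr_ae (ae_of_all _ fun x => by
      show (∑ k, ‖Torus.partialDeriv k (u t) x‖ ^ 2) ^ (4 : ℝ) = _
      rw [e4, Real.rpow_natCast])
  rw [e1, e2] at h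
  exact le_of_rpow_inv_four_le (integral_nonneg fun x => by positivity)
    (integral_nonneg fun x => by positivity) h

/-- `∫ (∑ᵢⱼ|Hᵢⱼ|)⁴ ≤ (#d²)³ ∑ᵢⱼ ∫|Hᵢⱼ|⁴` for continuous entries (power mean). [folklore] -/
theorem integral_sum_abs_pow_four_le {d : Type*} [Fintype d] {H : d → d → UnitAddTorus d → ℝ}
    (hH : ∀ i j, Continuous (H i j)) :
    ∫ x, (∑ i, ∑ j, |H i j x|) ^ 4 ≤
      ((Fintype.card d : ℝ) ^ 2) ^ 3 * ∑ i, ∑ j, ∫ x, |H i j x| ^ 4 := by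
  have hpt : ∀ x, (∑ i, ∑ j, |H i j x|) ^ 4 ≤
      ((Fintype.card d : ℝ) ^ 2) ^ 3 * ∑ i, ∑ j, |H i j x| ^ 4 := by
    intro x
    have h := pow_sum_le_card_mul_sum_pow (s := (Finset.univ : Finset (d × d)))
      (f := fun q : d × d => |H q.1 q.2 x|) (fun q _ => abs_nonneg _) 3
    rw [Fintype.sum_prod_type, Fintype.sum_prod_type] at h
    have h' : (∑ i, ∑ j, |H i j x|) ^ 4 ≤
        ((Fintype.card d : ℝ) * Fintype.card d) ^ 3 * ∑ i, ∑ j, |H i j x| ^ 4 := by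
      simpa using h
    calc (∑ i, ∑ j, |H i j x|) ^ 4
        ≤ ((Fintype.card d : ℝ) * Fintype.card d) ^ 3 * ∑ i, ∑ j, |H i j x| ^ 4 := h'
      _ = ((Fintype.card d : ℝ) ^ 2) ^ 3 * ∑ i, ∑ j, |H i j x| ^ 4 := by ring
  have hi : ∀ i j, Integrable (fun x => |H i j x| ^ 4) := fun i j =>
    ((hH i j).abs.pow 4).integrable_unitAddTorus
  calc ∫ x, (∑ i, ∑ j, |H i j x|) ^ 4
      ≤ ∫ x, ((Fintype.card d : ℝ) ^ 2) ^ 3 * ∑ i, ∑ j, |H i j x| ^ 4 := by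
        refine integral_mono_of_nonneg (ae_of_all _ fun x => by positivity) ?_ (ae_of_all _ hpt)
        exact (integrable_finsetSum _ fun i _ => integrable_finsetSum _ fun j _ => hi i j).const_mul _
    _ = ((Fintype.card d : ℝ) ^ 2) ^ 3 * ∑ i, ∑ j, ∫ x, |H i j x| ^ 4 := by
        rw [integral_const_mul, integral_finsetSum _ fun i _ =>
          integrable_finsetSum _ fun j _ => hi i j]
        congr 1
        exact Finset.sum_congr rfl fun i _ => integral_finsetSum _ fun j _ => hi i j

/-! ## 2. The two production bounds on `T³` -/

/-- **Nonlinear production bound (static, `T³`).** With a top-node constant `C_T`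
(`∫|S|¹² ≤ C_T I³`) and the strain Calderón–Zygmund constant `K` (`∫g⁴ ≤ K∫|S|⁸`): for every smooth
divergence-free `v` on `T³`,
`|∫ Q ∑ᵢⱼSᵢⱼ∑ₖ(∂ᵢv)ₖ(∂ₖv)ⱼ|¹⁴ ≤ 256(K+1)⁴(C_T+1)³ (∫Q²)⁶ (∫Q)⁵ I⁹`. [ours] -/
theorem nonlinear_production_bound {CT K : ℝ} (hCT0 : 0 ≤ CT) (hK0 : 0 ≤ K)
    (hCT : ∀ w : UnitAddTorus (Fin 3) → EuclideanSpace ℝ (Fin 3), IsSmooth w →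
      ∫ x, torusStrainSqAt w x ^ 6 ≤
        CT * (∫ x, torusStrainSqAt w x * ∑ k, ∑ i, ∑ j,
          ((partialDeriv k (partialDeriv j w) x i + partialDeriv k (partialDeriv i w) x j) / 2) ^ 2) ^ 3)
    (hK : ∀ w : UnitAddTorus (Fin 3) → EuclideanSpace ℝ (Fin 3), IsSmooth w → IsDivFree w →
      ∫ x, (∑ k, ‖partialDeriv k w x‖ ^ 2) ^ 4 ≤ K * ∫ x, torusStrainSqAt w x ^ 4)
    {v : UnitAddTorus (Fin 3) → EuclideanSpace ℝ (Fin 3)} (hv : IsSmooth v) (hdiv : IsDivFree v) :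
    |∫ x, torusStrainSqAt v x * ∑ i, ∑ j, (partialDeriv j v x i + partialDeriv i v x j) / 2 *
        ∑ k, partialDeriv i v x k * partialDeriv k v x j| ^ 14 ≤
      256 * (K + 1) ^ 4 * (CT + 1) ^ 3 * (∫ x, torusStrainSqAt v x ^ 2) ^ 6 *
        (∫ x, torusStrainSqAt v x) ^ 5 *
        (∫ x, torusStrainSqAt v x * ∑ k, ∑ i, ∑ j,
          ((partialDeriv k (partialDeriv j v) x i + partialDeriv k (partialDeriv i v) x j) / 2) ^ 2) ^ 9 := by
  have hQc := continuous_strainSqAt hv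
  have hQ0 := torusStrainSqAt_nonneg v
  have hgc := VorticityL4.continuous_gradSq hv
  obtain ⟨X, hX⟩ : ∃ X : ℝ, X = ∫ x, torusStrainSqAt v x * ∑ i, ∑ j,
      (partialDeriv j v x i + partialDeriv i v x j) / 2 *
        ∑ k, partialDeriv i v x k * partialDeriv k v x j := ⟨_, rfl⟩
  obtain ⟨B₄, hB₄⟩ : ∃ B : ℝ, B = ∫ x, torusStrainSqAt v x ^ 2 := ⟨_, rfl⟩
  obtain ⟨J, hJ⟩ : ∃ J : ℝ, J = ∫ x, torusStrainSqAt v x * (∑ k, ‖partialDeriv k v x‖ ^ 2) ^ 2 :=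
    ⟨_, rfl⟩
  obtain ⟨G₄, hG₄⟩ : ∃ G : ℝ, G = ∫ x, (∑ k, ‖partialDeriv k v x‖ ^ 2) ^ 4 := ⟨_, rfl⟩
  obtain ⟨B₈, hB₈⟩ : ∃ B : ℝ, B = ∫ x, torusStrainSqAt v x ^ 4 := ⟨_, rfl⟩
  obtain ⟨B₁₂, hB₁₂⟩ : ∃ B : ℝ, B = ∫ x, torusStrainSqAt v x ^ 6 := ⟨_, rfl⟩
  obtain ⟨B₂, hB₂⟩ : ∃ B : ℝ, B = ∫ x, torusStrainSqAt v x := ⟨_, rfl⟩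
  obtain ⟨I, hI⟩ : ∃ I : ℝ, I = ∫ x, torusStrainSqAt v x * ∑ k, ∑ i, ∑ j,
      ((partialDeriv k (partialDeriv j v) x i + partialDeriv k (partialDeriv i v) x j) / 2) ^ 2 :=
    ⟨_, rfl⟩
  have hB₄0 : 0 ≤ B₄ := by rw [hB₄]; exact integral_nonneg fun x => by positivity
  have hJ0 : 0 ≤ J := by rw [hJ]; exact integral_nonneg fun x => mul_nonneg (hQ0 x) (by positivity)
  have hG0 : 0 ≤ G₄ := by rw [hG₄]; exact integral_nonneg fun x => by positivity
  have hB₁₂0 : 0 ≤ B₁₂ := by rw [hB₁₂]; exact integral_nonneg fun x => pow_nonneg (hQ0 x) 6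
  have hB₂0 : 0 ≤ B₂ := by rw [hB₂]; exact integral_nonneg fun x => hQ0 x
  have hI0 : 0 ≤ I := by
    rw [hI]; exact integral_nonneg fun x => mul_nonneg (hQ0 x)
      (Finset.sum_nonneg fun k _ => Finset.sum_nonneg fun i _ => Finset.sum_nonneg fun j _ => sq_nonneg _)
  have h1 : |X| ^ 2 ≤ 2 * B₄ * J := by
    have h := sq_integral_mul_le_of_abs_le hQc hgc hQ0 (abs_nonlinearDensity_le v)
    rw [← hX, ← hB₄, ← hJ] at h
    rw [sq_abs]
    nlinarith [mul_nonneg hB₄0 hJ0]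
  have h2 : J ^ 2 ≤ B₄ * G₄ := by
    rw [hJ, hB₄, hG₄]; exact sq_integral_mul_sq_le hQc hgc
  have h3 : G₄ ≤ K * B₈ := by rw [hG₄, hB₈]; exact hK v hv hdiv
  have h4 : B₈ ^ 2 ≤ B₄ * B₁₂ := by
    rw [hB₈, hB₄, hB₁₂]; exact sq_integral_pow_four_le hQc
  have h5 : B₄ ^ 5 ≤ B₂ ^ 4 * B₁₂ := by
    rw [hB₄, hB₂, hB₁₂]; exact integral_sq_pow_five_le hQc hQ0
  have h6 : B₁₂ ≤ CT * I ^ 3 := by rw [hB₁₂, hI]; exact hCT v hv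
  have key := VorticityL4.production_pow_fourteen_le hB₄0 hG0 hB₁₂0 hB₂0 hI0 hK0 hCT0
    h1 h2 h3 h4 h5 h6
  rw [hX, hB₄, hB₂, hI] at key
  exact key

/-- **Pressure production bound (static along a solution, `T³`).** With `C_T`, `K` as above and
the pressure-Hessian constant `C_P` (`∫|∂ᵢ∂ⱼp|⁴ ≤ C_P∫g⁴`): along every classical solution of
unforced Navier–Stokes on `T³`, at every time `t` of the window,
`|∫ Q ∑ᵢⱼSᵢⱼ∂ᵢ∂ⱼp|¹⁴ ≤ 256(729·9·C_P·K+1)⁴(C_T+1)³ (∫Q²)⁶ (∫Q)⁵ I⁹`. [ours] -/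
theorem pressure_production_bound {CT K CP : ℝ} (hCT0 : 0 ≤ CT) (hK0 : 0 ≤ K) (hCP0 : 0 ≤ CP)
    (hCT : ∀ w : UnitAddTorus (Fin 3) → EuclideanSpace ℝ (Fin 3), IsSmooth w →
      ∫ x, torusStrainSqAt w x ^ 6 ≤
        CT * (∫ x, torusStrainSqAt w x * ∑ k, ∑ i, ∑ j,
          ((partialDeriv k (partialDeriv j w) x i + partialDeriv k (partialDeriv i w) x j) / 2) ^ 2) ^ 3)
    (hK : ∀ w : UnitAddTorus (Fin 3) → EuclideanSpace ℝ (Fin 3), IsSmooth w → IsDivFree w →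
      ∫ x, (∑ k, ‖partialDeriv k w x‖ ^ 2) ^ 4 ≤ K * ∫ x, torusStrainSqAt w x ^ 4)
    {a b ν : ℝ}
    {u : ℝ → UnitAddTorus (Fin 3) → EuclideanSpace ℝ (Fin 3)} {p : ℝ → UnitAddTorus (Fin 3) → ℝ}
    (hsol : IsClassicalNSSolutionOn (Icc a b) ν 0 u p)
    (hCP : ∀ t ∈ Icc a b, ∀ i j : Fin 3,
      ∫ x, |partialDeriv i (partialDeriv j (p t)) x| ^ 4 ≤
        CP * ∫ x, (∑ k, ‖partialDeriv k (u t) x‖ ^ 2) ^ 4)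
    {t : ℝ} (ht : t ∈ Icc a b) :
    |∫ x, torusStrainSqAt (u t) x * ∑ i, ∑ j,
        (partialDeriv j (u t) x i + partialDeriv i (u t) x j) / 2 *
          partialDeriv i (partialDeriv j (p t)) x| ^ 14 ≤
      256 * ((729 : ℝ) * 9 * CP * K + 1) ^ 4 * (CT + 1) ^ 3 *
        (∫ x, torusStrainSqAt (u t) x ^ 2) ^ 6 * (∫ x, torusStrainSqAt (u t) x) ^ 5 *
        (∫ x, torusStrainSqAt (u t) x * ∑ k, ∑ i, ∑ j,
          ((partialDeriv k (partialDeriv j (u t)) x i +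
            partialDeriv k (partialDeriv i (u t)) x j) / 2) ^ 2) ^ 9 := by
  have hv : IsSmooth (u t) := hsol.smooth_velocity.isSmooth_slice ht
  have hdiv : IsDivFree (u t) := hsol.divFree t ht
  have hpt : IsSmooth (p t) := hsol.smooth_pressure.isSmooth_slice ht
  have hQc := continuous_strainSqAt hv
  have hQ0 := torusStrainSqAt_nonneg (u t)
  have hgc := VorticityL4.continuous_gradSq hv
  have hhc := continuous_hessAbs hpt
  obtain ⟨X, hX⟩ : ∃ X : ℝ, X = ∫ x, torusStrainSqAt (u t) x * ∑ i, ∑ j,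
      (partialDeriv j (u t) x i + partialDeriv i (u t) x j) / 2 *
        partialDeriv i (partialDeriv j (p t)) x := ⟨_, rfl⟩
  obtain ⟨B₄, hB₄⟩ : ∃ B : ℝ, B = ∫ x, torusStrainSqAt (u t) x ^ 2 := ⟨_, rfl⟩
  obtain ⟨J, hJ⟩ : ∃ J : ℝ, J = ∫ x, torusStrainSqAt (u t) x *
      (∑ i, ∑ j, |partialDeriv i (partialDeriv j (p t)) x|) ^ 2 := ⟨_, rfl⟩
  obtain ⟨H₄, hH₄⟩ : ∃ H : ℝ, H = ∫ x, (∑ i, ∑ j, |partialDeriv i (partialDeriv j (p t)) x|) ^ 4 :=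
    ⟨_, rfl⟩
  obtain ⟨G₄, hG₄⟩ : ∃ G : ℝ, G = ∫ x, (∑ k, ‖partialDeriv k (u t) x‖ ^ 2) ^ 4 := ⟨_, rfl⟩
  obtain ⟨B₈, hB₈⟩ : ∃ B : ℝ, B = ∫ x, torusStrainSqAt (u t) x ^ 4 := ⟨_, rfl⟩
  obtain ⟨B₁₂, hB₁₂⟩ : ∃ B : ℝ, B = ∫ x, torusStrainSqAt (u t) x ^ 6 := ⟨_, rfl⟩
  obtain ⟨B₂, hB₂⟩ : ∃ B : ℝ, B = ∫ x, torusStrainSqAt (u t) x := ⟨_, rfl⟩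
  obtain ⟨I, hI⟩ : ∃ I : ℝ, I = ∫ x, torusStrainSqAt (u t) x * ∑ k, ∑ i, ∑ j,
      ((partialDeriv k (partialDeriv j (u t)) x i +
        partialDeriv k (partialDeriv i (u t)) x j) / 2) ^ 2 := ⟨_, rfl⟩
  have hB₄0 : 0 ≤ B₄ := by rw [hB₄]; exact integral_nonneg fun x => by positivity
  have hJ0 : 0 ≤ J := by rw [hJ]; exact integral_nonneg fun x => mul_nonneg (hQ0 x) (by positivity)
  have hH0 : 0 ≤ H₄ := by rw [hH₄]; exact integral_nonneg fun x => by positivity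
  have hG0 : 0 ≤ G₄ := by rw [hG₄]; exact integral_nonneg fun x => by positivity
  have hB₈0 : 0 ≤ B₈ := by rw [hB₈]; exact integral_nonneg fun x => pow_nonneg (hQ0 x) 4
  have hB₁₂0 : 0 ≤ B₁₂ := by rw [hB₁₂]; exact integral_nonneg fun x => pow_nonneg (hQ0 x) 6
  have hB₂0 : 0 ≤ B₂ := by rw [hB₂]; exact integral_nonneg fun x => hQ0 x
  have hI0 : 0 ≤ I := by
    rw [hI]; exact integral_nonneg fun x => mul_nonneg (hQ0 x)
      (Finset.sum_nonneg fun k _ => Finset.sum_nonneg fun i _ => Finset.sum_nonneg fun j _ => sq_nonneg _)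
  have h1 : |X| ^ 2 ≤ 2 * B₄ * J := by
    have h := sq_integral_mul_le_of_abs_le hQc hhc hQ0
      (fun x => abs_sum_strain_mul_le_sum_abs (u t) x
        (fun i j => partialDeriv i (partialDeriv j (p t)) x))
    rw [← hX, ← hB₄, ← hJ] at h
    rw [sq_abs]
    nlinarith [mul_nonneg hB₄0 hJ0]
  have h2 : J ^ 2 ≤ B₄ * H₄ := by
    rw [hJ, hB₄, hH₄]; exact sq_integral_mul_sq_le hQc hhc
  -- `H₄ ≤ 729·(9 C_P G₄) ≤ 729·9·C_P·K·B₈`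
  have h3 : H₄ ≤ (729 * 9 * CP * K) * B₈ := by
    have hH := integral_sum_abs_pow_four_le (d := Fin 3)
      (H := fun i j x => partialDeriv i (partialDeriv j (p t)) x)
      (fun i j => ((hpt.partialDeriv j).partialDeriv i).continuous)
    simp only [Fintype.card_fin, Nat.cast_ofNat] at hH
    have hsum : ∑ i : Fin 3, ∑ j : Fin 3, ∫ x, |partialDeriv i (partialDeriv j (p t)) x| ^ 4 ≤
        ∑ i : Fin 3, ∑ j : Fin 3, CP * G₄ := by
      refine Finset.sum_le_sum fun i _ => Finset.sum_le_sum fun j _ => ?_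
      rw [hG₄]; exact hCP t ht i j
    have hsum' : ∑ i : Fin 3, ∑ j : Fin 3, CP * G₄ = 9 * (CP * G₄) := by
      simp only [Finset.sum_const, Finset.card_univ, Fintype.card_fin]
      ring
    have hG : G₄ ≤ K * B₈ := by rw [hG₄, hB₈]; exact hK (u t) hv hdiv
    calc H₄ ≤ ((3 : ℝ) ^ 2) ^ 3 *
          ∑ i : Fin 3, ∑ j : Fin 3, ∫ x, |partialDeriv i (partialDeriv j (p t)) x| ^ 4 := by
          rw [hH₄]; exact hH
      _ ≤ ((3 : ℝ) ^ 2) ^ 3 * (9 * (CP * G₄)) := by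
          rw [← hsum']; exact mul_le_mul_of_nonneg_left hsum (by positivity)
      _ ≤ ((3 : ℝ) ^ 2) ^ 3 * (9 * (CP * (K * B₈))) := by gcongr
      _ = (729 * 9 * CP * K) * B₈ := by ring
  have h4 : B₈ ^ 2 ≤ B₄ * B₁₂ := by
    rw [hB₈, hB₄, hB₁₂]; exact sq_integral_pow_four_le hQc
  have h5 : B₄ ^ 5 ≤ B₂ ^ 4 * B₁₂ := by
    rw [hB₄, hB₂, hB₁₂]; exact integral_sq_pow_five_le hQc hQ0
  have h6 : B₁₂ ≤ CT * I ^ 3 := by rw [hB₁₂, hI]; exact hCT (u t) hv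
  have key := VorticityL4.production_pow_fourteen_le hB₄0 hH0 hB₁₂0 hB₂0 hI0
    (by positivity : (0 : ℝ) ≤ 729 * 9 * CP * K) hCT0 h1 h2 h3 h4 h5 h6
  rw [hX, hB₄, hB₂, hI] at key
  exact key

end StrainL4

end Summit.NavierStokesRegularity.FunctionalMining
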